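import Summits.QuantumFields.YangMills.Theorems.UnitScaleTiltProp7OneFormAgmonLetters
import Summits.QuantumFields.Balaban3D.Proofs.TorusBalls
import HarnessLib

/-!
# Route `UnitScaleTilt`, crux K1 «MinimiserStabilityRegPr» (stmt-QuantumFields-19200), EX face S45 — (L3′b)-VALUE, ONE-FORM STOREY, pen (P-1FA) «ONE-FORM AGMON», FILE A2d:
# **THE LOCAL PAIR `η⁻²(Δ′₁ − 𝒦)` IS RANGE-ONE LOCAL, HENCE `L²`-SMALL AND SMALL UNDER CONJUGATION** — the letters `hloc` of A1 ✓`Prop7OneFormGarding.katoEnergy_le` and `hlocw` of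
# A2c ✓∕⧗`Prop7OneFormAgmonConj.hVconj_of_letters` DISCHARGED at a printed-regular background (`C_loc = C_locw-class = 32√2·6·(2·3)³·ε₀·(1+ρ)²`, K-FREE)

Cell `ym3-torus` (HUMAN RULING D-0037; rung R3 = SU(2) YM₃ on T³ — NOT d = 4, NOT infinite volume, NOT a mass gap, NOT Clay).  Width seat `ym3-torus-px21` (gen 14).
THEOREMS ONLY (0 `def`, 0 `sorry`); `--supports stmt-QuantumFields-19200 --as helper`; count-neutral.

WHY.  O1 ✓`Prop7OneFormKatoForm.norm_local_remainder_le_of_regPr` bounds the local pair SUP → SUP (`≤ 32ε₀·sup‖X‖`); the one-form Agmon bound needs it in `L²` and CONJUGATED by an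
unbounded weight `w(b₋)`, which is only possible because the pair is LOCAL: lit `deltaPrimeOp` (= `divP∘jordanF + divL∘commG`) and `curvOp` read the field at the sites
`x, x ± e_ν, x + e_μ − e_ν, x + e_μ` only.  §1 states that locality as `congr` lemmas (pure unfolding, any ring ∕ torus ∕ background); §2 turns O1's sup letter into a POINTWISE
stencil bound by truncating the field to the radius-2 ball of `b₋`; §3 is the `L²`∕Schur edition, conjugated by any positive weight with per-bond ratios `≤ ρ` (the weight meets only
the five stencil forms, so `(1+ρ)²` suffices), and the ball count lit-side ✓`TorusBalls.card_torusBall_le` (`≤ (2·3)³`).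
WHAT IS PROVED (ns `Summit.QuantumFields.YangMills.Theorems.Prop7OneFormAgmonLocal`).
* §1 `deltaPrimeOp_congr_of_agree`, `curvOp_congr_of_agree` (locality of the lit operators: agreement on the stencil ⟹ equal value).
* §2 ★ `norm_local_truncated_le_of_regPr` — at `RegPr F n K ε₀ U₀`, for every positive `w` with both bond ratios `≤ ρ`, bond field `X` and bond `b`:
  `‖(η⁻²(Δ′₁ − 𝒦)((w(b₋))⁻¹·X))(b)‖ ≤ 32ε₀·(1+ρ)²·(w(b₋))⁻¹·Σ_{b′ : tdist(b₋, b′₋) ≤ 2} ‖X b′‖_F`.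
* §3 ★★ `abs_re_inner_local_conj_le` — `|re⟪toL2(w(b₋)·X), toL2(η⁻²(Δ′₁−𝒦)((w(b₋))⁻¹·X))⟫| ≤ 32√2·ε₀·(1+ρ)²·(d·(2·3)^d)·‖toL2 X‖²`; ★★ `abs_re_inner_local_le` (`w = 1`: the `hloc`
  letter of A1 with `C_loc = 32√2·ε₀·d·6^d`); ★★★ `hlocw_of_regPr` — A2c's `hlocw` VERBATIM with `C_locw := 2·32√2·ε₀·(1+ρ)²·d·6^d`.
HYP-SAT (★★OWNER RULING №42): `RegPr` only (the plaquette clause, through O1's letter); the weight rows are A3's `hρ`∕`hρ′`; nothing eventual; no hypothesis restates a conclusion.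
HONEST SCOPE.  Locality bookkeeping; nothing of the ten EX rows, `hT`, EX or the crux is proved here; the Yang–Mills mass gap is NOT proved.

References: T. Bałaban, CMP **99** (1985) 389–434 [Balaban1985BackgroundPropagators] ((3.10)–(3.11) p.392, Thm 3.1 (3.46) p.398); CMP **102** (1985) 277–309 [Balaban1985Variational]
((14) p.280, (134)–(136) p.298, p.299); S. Agmon, *Lectures on exponential decay* (Princeton 1982) Ch. 1 [Agmon1982].
-/

set_option autoImplicit false

noncomputable section

open scoped BigOperators Matrix.Norms.L2Operator InnerProductSpace ComplexConjugate

namespace Summit.QuantumFields.YangMills.Theorems.Prop7OneFormAgmonLocal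

open Literature.MathematicalPhysics.QuantumFieldTheory.Balaban1983to89
open Literature.MathematicalPhysics.QuantumFieldTheory.Balaban1983to89.T3ContinuumYM3Torus
open T3SectALandauChart (eta eta_pos bgUnits formComp)
open T3PrintedRegularMinimiser (RegPr)
open B9TorusCalculus (torusT torusT_apply torusT_symm_apply)
open B9Eq39Adjoint (R divP curl covD covDstar)
open B9Eq310Hermitian (deltaPrimeOp divL jordanF commG₁ commG₂ commG₃ commG₄ sgnSum₁ sgnSum₂ sgnSum₃ sgnSum₄)
open B11Eq135Weitzenbock (curvOp)
open B11Eq103H1Complex (SiteL2K BondL2K)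
open B3Taylor310LocalRemainder (tdist_comm tdist_triangle)
open B5Display136Torus (shift_unshift unshift_shift)
open Summit.QuantumFields.Balaban3D.Proofs.Run3Collar (tdist_shift_le)
open Summit.QuantumFields.Balaban3D.Proofs.TorusBalls (card_torusBall_le)
open Summit.QuantumFields.YangMills.Theorems.Prop7SectET3Transport (periodsT3)
open Summit.QuantumFields.YangMills.Theorems.Prop7SectET3HilbertLetters (W₂ frobEquiv toL2 inner_toL2)
open Summit.QuantumFields.YangMills.Theorems.Prop7RieszTauFrobNorm (norm_sq_frobEquiv_symm norm_le_norm_frobEquiv_symm norm_frobEquiv_symm_le)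
open Summit.QuantumFields.YangMills.Theorems.Prop7LaplaceAFlatLetters (norm_sq_toL2)
open Summit.QuantumFields.YangMills.Theorems.Prop7SectET3DeltaEtaExplicit (sum_pbond_eq)
open Summit.QuantumFields.YangMills.Theorems.Prop7OneFormKatoForm (norm_local_remainder_le_of_regPr)
open Summit.QuantumFields.YangMills.Theorems.Prop7OneFormAgmonLetters (sum_sum_mul_le_of_row_le)

/-! ## §1 Locality of the lit operators `Δ′` and `𝒦` -/

section Congr

variable {𝔸 : Type*} [Ring 𝔸] [Algebra ℂ 𝔸] {S : Type*} {ι : Type*} [Fintype ι] [LinearOrder ι] (T : ι → Equiv.Perm S) (U : ι → S → 𝔸ˣ)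

/-- **`Δ′` IS RANGE-ONE LOCAL**: `(Δ′A)_μ(x)` reads `A` only at `x`, `T_ν x`, `T_ν⁻¹ x`, `T_μ T_ν⁻¹ x` (all `ν`), so two fields agreeing there give the same value (unfolding lit's
`divP∘jordanF + divL∘commG₁..₄`). [cite: Balaban1985BackgroundPropagators, (3.10) p.392] -/
theorem deltaPrimeOp_congr_of_agree (η : ℝ) {A A' : ι → S → 𝔸} (μ : ι) (x : S)
    (h1 : ∀ κ, A κ x = A' κ x) (h3 : ∀ κ ν, A κ (T ν x) = A' κ (T ν x))
    (h4 : ∀ κ ν, A κ ((T ν).symm x) = A' κ ((T ν).symm x)) (h5 : ∀ κ ν, A κ (T μ ((T ν).symm x)) = A' κ (T μ ((T ν).symm x))) :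
    deltaPrimeOp T U η A μ x = deltaPrimeOp T U η A' μ x := by
  simp only [deltaPrimeOp, divP, divL, jordanF, commG₁, commG₂, commG₃, commG₄, sgnSum₁, sgnSum₂, sgnSum₃, sgnSum₄, curl, covD, covDstar,
    Equiv.apply_symm_apply, h1, h3, h4, h5]

omit [Algebra ℂ 𝔸] [LinearOrder ι] in
/-- **`𝒦` IS RANGE-ONE LOCAL**: `(𝒦A)_μ(x)` reads `A_ν` only at `T_ν⁻¹ T_μ x`. [cite: Balaban1985Variational, (135)–(136) p.298] -/
theorem curvOp_congr_of_agree {A A' : ι → S → 𝔸} (μ : ι) (x : S)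
    (h : ∀ κ ν, A κ ((T ν).symm (T μ x)) = A' κ ((T ν).symm (T μ x))) :
    curvOp T U A μ x = curvOp T U A' μ x := by
  simp only [curvOp, h]

end Congr

/-! ## §2 The pointwise stencil bound at the member, conjugated by the weight -/

section Member

variable (F : T3Family) {n K : ℕ} {c₀ : ℝ} [Fact (0 < c₀)] (U₀ : GaugeField (F.P K) 0 (Matrix.specialUnitaryGroup (Fin 2) ℂ))

/-- `|q − 1| ≤ ρ ⟹ q ≤ 1 + ρ`. [folklore] -/
theorem le_one_add_of_abs_sub_one_le {q ρ : ℝ} (h : |q - 1| ≤ ρ) : q ≤ 1 + ρ := by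
  have := (abs_le.mp h).2; linarith

/-- **THE FIVE STENCIL RATIOS**: for a positive weight with both bond ratios `≤ ρ`, `w(x)∕w(y) ≤ (1+ρ)²` for `y ∈ {x, x+e_ν, x−e_ν, x−e_ν+e_μ, x+e_μ−e_ν}`. [folklore] -/
theorem ratio_le_of_stencil (w : Site (F.P K) 0 → ℝ) (hw : ∀ x, 0 < w x) {ρ : ℝ}
    (hρ : ∀ b : PBond (F.P K) 0, |w b.tgt / w b.src - 1| ≤ ρ ∧ |w b.src / w b.tgt - 1| ≤ ρ)
    (x : Site (F.P K) 0) (μ : Fin (F.P K).d) (y : Site (F.P K) 0)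
    (hy : y = x ∨ ∃ ν : Fin (F.P K).d, y = x.shift ν ∨ y = x.unshift ν ∨ y = (x.unshift ν).shift μ ∨ y = (x.shift μ).unshift ν) :
    w x / w y ≤ (1 + ρ) ^ 2 := by
  have hρ0 : 0 ≤ ρ := (abs_nonneg _).trans (hρ ⟨x, μ⟩).1
  -- one step along a bond: `w(src)∕w(tgt) ≤ 1+ρ` and `w(tgt)∕w(src) ≤ 1+ρ`
  have hst : ∀ (y : Site (F.P K) 0) (ν : Fin (F.P K).d), w y / w (y.shift ν) ≤ 1 + ρ := fun y ν =>
    le_one_add_of_abs_sub_one_le (hρ ⟨y, ν⟩).2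
  have hts : ∀ (y : Site (F.P K) 0) (ν : Fin (F.P K).d), w (y.shift ν) / w y ≤ 1 + ρ := fun y ν =>
    le_one_add_of_abs_sub_one_le (hρ ⟨y, ν⟩).1
  have h1 : (1 : ℝ) ≤ (1 + ρ) ^ 2 := by nlinarith
  have h2 : 1 + ρ ≤ (1 + ρ) ^ 2 := by nlinarith
  rcases hy with rfl | ⟨ν, hν⟩
  · rw [div_self (hw _).ne']; exact h1
  rcases hν with rfl | rfl | rfl | rfl
  · exact (hst x ν).trans h2
  · have := hts (x.unshift ν) ν
    rw [shift_unshift] at this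
    exact this.trans h2
  · have ha := hts (x.unshift ν) ν
    rw [shift_unshift] at ha
    have hb := hst (x.unshift ν) μ
    have e : w x / w ((x.unshift ν).shift μ) = (w x / w (x.unshift ν)) * (w (x.unshift ν) / w ((x.unshift ν).shift μ)) := by
      field_simp [(hw (x.unshift ν)).ne']
    rw [e, sq]
    exact mul_le_mul ha hb (div_pos (hw _) (hw _)).le (by linarith)
  · have ha := hst x μ
    have hb := hts ((x.shift μ).unshift ν) ν
    rw [shift_unshift] at hb
    have e : w x / w ((x.shift μ).unshift ν) = (w x / w (x.shift μ)) * (w (x.shift μ) / w ((x.shift μ).unshift ν)) := by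
      field_simp [(hw (x.shift μ)).ne']
    rw [e, sq]
    exact mul_le_mul ha hb (div_pos (hw _) (hw _)).le (by linarith)

omit [Fact (0 < c₀)] in
/-- **THE STENCIL LIES IN THE RADIUS-2 BALL** (`ℓ¹` torus distance ✓`Run3Collar.tdist_shift_le`, ✓`tdist_triangle`). [folklore] -/
theorem tdist_le_two_of_stencil (x : Site (F.P K) 0) (μ : Fin (F.P K).d) (y : Site (F.P K) 0)
    (hy : y = x ∨ ∃ ν : Fin (F.P K).d, y = x.shift ν ∨ y = x.unshift ν ∨ y = (x.unshift ν).shift μ ∨ y = (x.shift μ).unshift ν) :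
    Site.tdist x y ≤ 2 := by
  have hsh : ∀ (y : Site (F.P K) 0) (ν : Fin (F.P K).d), Site.tdist y (y.shift ν) ≤ 1 := fun y ν => tdist_shift_le y ν
  have hun : ∀ (y : Site (F.P K) 0) (ν : Fin (F.P K).d), Site.tdist y (y.unshift ν) ≤ 1 := fun y ν => by
    have := hsh (y.unshift ν) ν
    rw [shift_unshift] at this
    rwa [tdist_comm]
  rcases hy with rfl | ⟨ν, hν⟩
  · simp [Site.tdist]
  rcases hν with rfl | rfl | rfl | rfl
  · exact (hsh x ν).trans (by norm_num)
  · exact (hun x ν).trans (by norm_num)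
  · calc Site.tdist x ((x.unshift ν).shift μ) ≤ Site.tdist x (x.unshift ν) + Site.tdist (x.unshift ν) ((x.unshift ν).shift μ) := tdist_triangle _ _ _
      _ ≤ 1 + 1 := Nat.add_le_add (hun x ν) (hsh _ μ)
  · calc Site.tdist x ((x.shift μ).unshift ν) ≤ Site.tdist x (x.shift μ) + Site.tdist (x.shift μ) ((x.shift μ).unshift ν) := tdist_triangle _ _ _
      _ ≤ 1 + 1 := Nat.add_le_add (hsh x μ) (hun _ ν)

/-- ★ **THE LOCAL PAIR OF A CONJUGATED FIELD IS CONTROLLED BY THE RADIUS-2 BALL**: at `RegPr F n K ε₀ U₀`, for a positive weight with both bond ratios `≤ ρ`, every bond field `X` and bond `b`,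
`‖(η⁻²(Δ′₁ − 𝒦)((w(b′₋))⁻¹·X))(b)‖ ≤ 32ε₀·((1+ρ)²·w(b₋)⁻¹·Σ_{b′ : tdist(b₋,b′₋) ≤ 2} ‖X b′‖_F)` — O1's sup letter ✓`norm_local_remainder_le_of_regPr` applied to the field TRUNCATED to
the stencil of `b` (§1: same value), whose sup is bounded by the five stencil ratios times the ball sum. [cite: Balaban1985Variational, (14) p.280, (135)–(136) p.298; Balaban1985BackgroundPropagators, (3.10) p.392] -/
theorem norm_local_conj_le_of_regPr {ε₀ : ℝ} (hreg : RegPr F n K ε₀ U₀)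
    (w : Site (F.P K) 0 → ℝ) (hw : ∀ x, 0 < w x) {ρ : ℝ}
    (hρ : ∀ b : PBond (F.P K) 0, |w b.tgt / w b.src - 1| ≤ ρ ∧ |w b.src / w b.tgt - 1| ≤ ρ)
    (X : PBond (F.P K) 0 → Matrix (Fin 2) (Fin 2) ℂ) (b : PBond (F.P K) 0) :
    ‖(eta F n K)⁻¹ • (eta F n K)⁻¹ •
        (deltaPrimeOp (torusT (F.P K) 0) (fun μ x => bgUnits F K U₀ ⟨x, μ⟩) 1 (formComp (fun b' : PBond (F.P K) 0 => (w b'.src)⁻¹ • X b')) b.dir b.src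
          - curvOp (torusT (F.P K) 0) (fun μ x => bgUnits F K U₀ ⟨x, μ⟩) (formComp (fun b' : PBond (F.P K) 0 => (w b'.src)⁻¹ • X b')) b.dir b.src)‖
      ≤ 32 * ε₀ * ((1 + ρ) ^ 2 * (w b.src)⁻¹ *
          ∑ b' : PBond (F.P K) 0, (if Site.tdist b.src b'.src ≤ 2 then ‖(frobEquiv.symm (X b') : W₂)‖ else 0)) := by
  classical
  have hρ0 : 0 ≤ ρ := (abs_nonneg _).trans (hρ b).1
  -- the stencil of `b` and the truncated field
  set x := b.src with hx
  set μ := b.dir with hμ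
  set Z : PBond (F.P K) 0 → Matrix (Fin 2) (Fin 2) ℂ := fun b' =>
    if (b'.src = x ∨ ∃ ν : Fin (F.P K).d, b'.src = x.shift ν ∨ b'.src = x.unshift ν ∨ b'.src = (x.unshift ν).shift μ ∨ b'.src = (x.shift μ).unshift ν)
    then (w b'.src)⁻¹ • X b' else 0 with hZ
  set S : ℝ := ∑ b' : PBond (F.P K) 0, (if Site.tdist b.src b'.src ≤ 2 then ‖(frobEquiv.symm (X b') : W₂)‖ else 0) with hS
  have hS0 : 0 ≤ S := Finset.sum_nonneg fun b' _ => by split_ifs <;> first | exact norm_nonneg _ | exact le_rfl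
  set s : ℝ := (1 + ρ) ^ 2 * (w b.src)⁻¹ * S with hs
  have hwx : 0 < w b.src := hw _
  -- the sup of the truncated field
  have hZle : ∀ b' : PBond (F.P K) 0, ‖Z b'‖ ≤ s := by
    intro b'
    by_cases hst : (b'.src = x ∨ ∃ ν : Fin (F.P K).d, b'.src = x.shift ν ∨ b'.src = x.unshift ν ∨ b'.src = (x.unshift ν).shift μ ∨ b'.src = (x.shift μ).unshift ν)
    · simp only [hZ, if_pos hst]
      rw [norm_smul, norm_inv, Real.norm_of_nonneg (hw _).le]
      have hrat : (w b'.src)⁻¹ ≤ (1 + ρ) ^ 2 * (w b.src)⁻¹ := by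
        have hr := ratio_le_of_stencil F w hw hρ x μ b'.src hst
        rw [div_le_iff₀ (hw _)] at hr
        rw [inv_le_iff_one_le_mul₀ (hw _)]
        calc (1 : ℝ) = w x * (w b.src)⁻¹ := by rw [hx, mul_inv_cancel₀ hwx.ne']
          _ ≤ (1 + ρ) ^ 2 * w b'.src * (w b.src)⁻¹ := by gcongr
          _ = (1 + ρ) ^ 2 * (w b.src)⁻¹ * w b'.src := by ring
      have hin : ‖X b'‖ ≤ S := by
        have hd := tdist_le_two_of_stencil F x μ b'.src hst
        calc ‖X b'‖ ≤ ‖(frobEquiv.symm (X b') : W₂)‖ := norm_le_norm_frobEquiv_symm _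
          _ = (if Site.tdist b.src b'.src ≤ 2 then ‖(frobEquiv.symm (X b') : W₂)‖ else 0) := by rw [if_pos (by rw [← hx]; exact hd)]
          _ ≤ S := Finset.single_le_sum (f := fun b'' : PBond (F.P K) 0 => (if Site.tdist b.src b''.src ≤ 2 then ‖(frobEquiv.symm (X b'') : W₂)‖ else 0))
              (fun b'' _ => by split_ifs <;> first | exact norm_nonneg _ | exact le_rfl) (Finset.mem_univ b')
      calc (w b'.src)⁻¹ * ‖X b'‖ ≤ ((1 + ρ) ^ 2 * (w b.src)⁻¹) * S := mul_le_mul hrat hin (norm_nonneg _) (by positivity)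
        _ = s := by rw [hs]
    · simp only [hZ, if_neg hst, norm_zero]
      positivity
  -- the truncated field agrees with the conjugated one on the stencil
  have hag : ∀ (κ : Fin (F.P K).d) (y : Site (F.P K) 0),
      (y = x ∨ ∃ ν : Fin (F.P K).d, y = x.shift ν ∨ y = x.unshift ν ∨ y = (x.unshift ν).shift μ ∨ y = (x.shift μ).unshift ν) →
      formComp Z κ y = formComp (fun b' : PBond (F.P K) 0 => (w b'.src)⁻¹ • X b') κ y := by
    intro κ y hy
    show Z ⟨y, κ⟩ = (w y)⁻¹ • X ⟨y, κ⟩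
    simp only [hZ]
    rw [if_pos hy]
  have hΔ : deltaPrimeOp (torusT (F.P K) 0) (fun μ x => bgUnits F K U₀ ⟨x, μ⟩) 1 (formComp Z) b.dir b.src
      = deltaPrimeOp (torusT (F.P K) 0) (fun μ x => bgUnits F K U₀ ⟨x, μ⟩) 1 (formComp (fun b' : PBond (F.P K) 0 => (w b'.src)⁻¹ • X b')) b.dir b.src := by
    refine deltaPrimeOp_congr_of_agree _ _ 1 b.dir b.src (fun κ => hag κ _ (Or.inl hx.symm)) (fun κ ν => hag κ _ ?_) (fun κ ν => hag κ _ ?_) (fun κ ν => hag κ _ ?_)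
    · exact Or.inr ⟨ν, Or.inl (by rw [torusT_apply, hx])⟩
    · exact Or.inr ⟨ν, Or.inr (Or.inl (by rw [torusT_symm_apply, hx]))⟩
    · exact Or.inr ⟨ν, Or.inr (Or.inr (Or.inl (by rw [torusT_symm_apply, torusT_apply, hx, hμ])))⟩
  have hK : curvOp (torusT (F.P K) 0) (fun μ x => bgUnits F K U₀ ⟨x, μ⟩) (formComp Z) b.dir b.src
      = curvOp (torusT (F.P K) 0) (fun μ x => bgUnits F K U₀ ⟨x, μ⟩) (formComp (fun b' : PBond (F.P K) 0 => (w b'.src)⁻¹ • X b')) b.dir b.src :=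
    curvOp_congr_of_agree _ _ b.dir b.src fun κ ν => hag κ _ (Or.inr ⟨ν, Or.inr (Or.inr (Or.inr (by rw [torusT_symm_apply, torusT_apply, hx, hμ])))⟩)
  have hO1 := norm_local_remainder_le_of_regPr F (n := n) U₀ hreg hZle b
  rw [hΔ, hK] at hO1
  rw [hs] at hO1
  exact hO1

end Member

/-! ## §3 The `L²`∕Schur edition: the letters `hloc` (A1) and `hlocw` (A2c) at a printed-regular background -/

section L2

variable (F : T3Family) {n K : ℕ} (c₀ : ℝ) [Fact (0 < c₀)] (U₀ : GaugeField (F.P K) 0 (Matrix.specialUnitaryGroup (Fin 2) ℂ))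

omit [Fact (0 < c₀)] in
/-- **THE BOND ROW SUM OF THE RADIUS-2 BALL INDICATOR**: `#{b′ : tdist(x, b′₋) ≤ 2} ≤ d·(2·3)^d` (lit-side ✓`TorusBalls.card_torusBall_le`, `d` directions per source). [folklore] -/
theorem sum_pbond_ball_indicator_le (x : Site (F.P K) 0) :
    ∑ b' : PBond (F.P K) 0, (if Site.tdist x b'.src ≤ 2 then (1 : ℝ) else 0) ≤ ((F.P K).d : ℝ) * (2 * 3) ^ (F.P K).d := by
  classical
  rw [sum_pbond_eq]
  have hinner : ∀ y : Site (F.P K) 0, ∑ κ : Fin (F.P K).d, (if Site.tdist x y ≤ 2 then (1 : ℝ) else 0) = ((F.P K).d : ℝ) * (if Site.tdist x y ≤ 2 then (1 : ℝ) else 0) := fun y => by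
    rw [Finset.sum_const, Finset.card_univ, Fintype.card_fin, nsmul_eq_mul]
  rw [Finset.sum_congr rfl fun y _ => hinner y, ← Finset.mul_sum, Finset.sum_boole]
  refine mul_le_mul_of_nonneg_left ?_ (Nat.cast_nonneg _)
  have hc := card_torusBall_le x 2
  calc (((Finset.univ : Finset (Site (F.P K) 0)).filter (fun y => Site.tdist x y ≤ 2)).card : ℝ) ≤ ((2 * (2 + 1)) ^ (F.P K).d : ℕ) := by exact_mod_cast hc
    _ = (2 * 3) ^ (F.P K).d := by norm_num

/-- ★★ **THE LOCAL PAIR, CONJUGATED BY THE WEIGHT, IN `L²`**: at `RegPr F n K ε₀ U₀` (`0 ≤ ε₀`), for a positive site weight with both bond ratios `≤ ρ` and every bond field `X`,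
`|re⟪toL2(w(b₋)·X), toL2(η⁻²(Δ′₁ − 𝒦)(w(b₋)⁻¹·X))⟫| ≤ 32√2·ε₀·(1+ρ)²·(d·6^d)·‖toL2 X‖²` — §2 pointwise, the weights cancel up to the stencil ratio `(1+ρ)²`, and Schur's test on the
SYMMETRIC ball indicator (✓`tdist_comm`) with the row bound `sum_pbond_ball_indicator_le`.  K-FREE, `O(ε₀)`. [cite: Balaban1985Variational, (134)–(136) p.298, p.299; Balaban1985BackgroundPropagators, Thm 3.1 (3.46) p.398] -/
theorem abs_re_inner_local_conj_le {ε₀ : ℝ} (hε₀ : 0 ≤ ε₀) (hreg : RegPr F n K ε₀ U₀)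
    (w : Site (F.P K) 0 → ℝ) (hw : ∀ x, 0 < w x) {ρ : ℝ}
    (hρ : ∀ b : PBond (F.P K) 0, |w b.tgt / w b.src - 1| ≤ ρ ∧ |w b.src / w b.tgt - 1| ≤ ρ)
    (X : PBond (F.P K) 0 → Matrix (Fin 2) (Fin 2) ℂ) :
    |RCLike.re ⟪toL2 F K c₀ (fun b => w b.src • X b), toL2 F K c₀ (fun b : PBond (F.P K) 0 => (eta F n K)⁻¹ • (eta F n K)⁻¹ •
        (deltaPrimeOp (torusT (F.P K) 0) (fun μ x => bgUnits F K U₀ ⟨x, μ⟩) 1 (formComp (fun b' : PBond (F.P K) 0 => (w b'.src)⁻¹ • X b')) b.dir b.src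
          - curvOp (torusT (F.P K) 0) (fun μ x => bgUnits F K U₀ ⟨x, μ⟩) (formComp (fun b' : PBond (F.P K) 0 => (w b'.src)⁻¹ • X b')) b.dir b.src))⟫_ℂ|
      ≤ 32 * Real.sqrt 2 * ε₀ * (1 + ρ) ^ 2 * (((F.P K).d : ℝ) * (2 * 3) ^ (F.P K).d) * ‖toL2 F K c₀ X‖ ^ 2 := by
  classical
  have hc₀ : 0 < c₀ := Fact.out
  have hρ0 : 0 ≤ ρ := by
    obtain ⟨x⟩ := (inferInstance : Nonempty (Site (F.P K) 0))
    exact (abs_nonneg _).trans (hρ ⟨x, 0⟩).1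
  set Lc : PBond (F.P K) 0 → Matrix (Fin 2) (Fin 2) ℂ := fun b : PBond (F.P K) 0 => (eta F n K)⁻¹ • (eta F n K)⁻¹ •
        (deltaPrimeOp (torusT (F.P K) 0) (fun μ x => bgUnits F K U₀ ⟨x, μ⟩) 1 (formComp (fun b' : PBond (F.P K) 0 => (w b'.src)⁻¹ • X b')) b.dir b.src
          - curvOp (torusT (F.P K) 0) (fun μ x => bgUnits F K U₀ ⟨x, μ⟩) (formComp (fun b' : PBond (F.P K) 0 => (w b'.src)⁻¹ • X b')) b.dir b.src) with hLc
  set f : PBond (F.P K) 0 → ℝ := fun b => ‖(frobEquiv.symm (X b) : W₂)‖ with hf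
  set Kf : PBond (F.P K) 0 → PBond (F.P K) 0 → ℝ := fun b b' => if Site.tdist b.src b'.src ≤ 2 then (1 : ℝ) else 0 with hKf
  set C : ℝ := 32 * ε₀ * (1 + ρ) ^ 2 with hC
  have hC0 : 0 ≤ C := by positivity
  -- pointwise (§2), rewritten against the indicator kernel
  have hpt : ∀ b : PBond (F.P K) 0, ‖Lc b‖ ≤ C * ((w b.src)⁻¹ * ∑ b', Kf b b' * f b') := by
    intro b
    have h2 := norm_local_conj_le_of_regPr F U₀ hreg w hw hρ X b
    have hsum : ∑ b' : PBond (F.P K) 0, (if Site.tdist b.src b'.src ≤ 2 then ‖(frobEquiv.symm (X b') : W₂)‖ else 0) = ∑ b', Kf b b' * f b' :=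
      Finset.sum_congr rfl fun b' _ => by simp only [hKf, hf, ite_mul, one_mul, zero_mul]
    rw [hsum] at h2
    calc ‖Lc b‖ ≤ 32 * ε₀ * ((1 + ρ) ^ 2 * (w b.src)⁻¹ * ∑ b', Kf b b' * f b') := h2
      _ = C * ((w b.src)⁻¹ * ∑ b', Kf b b' * f b') := by rw [hC]; ring
  -- the pairing, entrywise
  have hterm : ∀ b : PBond (F.P K) 0, ‖Matrix.trace (((fun b => w b.src • X b) b).conjTranspose * Lc b)‖ ≤ Real.sqrt 2 * C * ∑ b', Kf b b' * (f b * f b') := by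
    intro b
    rw [← Prop7SectET3HilbertLetters.inner_frobEquiv_symm]
    have hn1 : ‖(frobEquiv.symm (w b.src • X b) : W₂)‖ = w b.src * f b := by
      rw [← Complex.coe_smul, map_smul, norm_smul, Complex.norm_real, Real.norm_of_nonneg (hw _).le]
    have hn2 : ‖(frobEquiv.symm (Lc b) : W₂)‖ ≤ Real.sqrt 2 * (C * ((w b.src)⁻¹ * ∑ b', Kf b b' * f b')) :=
      (norm_frobEquiv_symm_le _).trans (mul_le_mul_of_nonneg_left (hpt b) (Real.sqrt_nonneg _))
    have hS0 : 0 ≤ ∑ b', Kf b b' * f b' := Finset.sum_nonneg fun b' _ => by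
      have : 0 ≤ Kf b b' := by simp only [hKf]; split_ifs <;> norm_num
      exact mul_nonneg this (norm_nonneg _)
    calc ‖⟪(frobEquiv.symm (w b.src • X b) : W₂), frobEquiv.symm (Lc b)⟫_ℂ‖
        ≤ ‖(frobEquiv.symm (w b.src • X b) : W₂)‖ * ‖(frobEquiv.symm (Lc b) : W₂)‖ := norm_inner_le_norm _ _
      _ ≤ (w b.src * f b) * (Real.sqrt 2 * (C * ((w b.src)⁻¹ * ∑ b', Kf b b' * f b'))) := by
          rw [hn1]; exact mul_le_mul_of_nonneg_left hn2 (mul_nonneg (hw _).le (norm_nonneg _))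
      _ = Real.sqrt 2 * C * (w b.src * (w b.src)⁻¹) * (f b * ∑ b', Kf b b' * f b') := by ring
      _ = Real.sqrt 2 * C * ∑ b', Kf b b' * (f b * f b') := by
          rw [mul_inv_cancel₀ (hw _).ne', mul_one, Finset.mul_sum, Finset.mul_sum, Finset.mul_sum]
          exact Finset.sum_congr rfl fun b' _ => by ring
  -- Schur on the ball indicator
  have hrow : ∀ b : PBond (F.P K) 0, ∑ b', Kf b b' ≤ ((F.P K).d : ℝ) * (2 * 3) ^ (F.P K).d := fun b => by
    simp only [hKf]; exact sum_pbond_ball_indicator_le F b.src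
  have hschur := sum_sum_mul_le_of_row_le Kf (fun b b' => by simp only [hKf]; split_ifs <;> norm_num)
    (fun b b' => by simp only [hKf, tdist_comm b.src b'.src]) hrow f
  have hnormX : ‖toL2 F K c₀ X‖ ^ 2 = c₀ * ∑ b, f b ^ 2 := by
    rw [norm_sq_toL2]; congr 1; exact Finset.sum_congr rfl fun b _ => (norm_sq_frobEquiv_symm (X b)).symm
  -- assemble
  rw [inner_toL2]
  calc |RCLike.re ((c₀ : ℂ) * ∑ b : PBond (F.P K) 0, Matrix.trace (((fun b => w b.src • X b) b).conjTranspose * Lc b))|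
      ≤ ‖(c₀ : ℂ) * ∑ b : PBond (F.P K) 0, Matrix.trace (((fun b => w b.src • X b) b).conjTranspose * Lc b)‖ := RCLike.abs_re_le_norm _
    _ ≤ c₀ * ∑ b : PBond (F.P K) 0, Real.sqrt 2 * C * ∑ b', Kf b b' * (f b * f b') := by
        rw [norm_mul, Complex.norm_real, Real.norm_of_nonneg hc₀.le]
        exact mul_le_mul_of_nonneg_left ((norm_sum_le _ _).trans (Finset.sum_le_sum fun b _ => hterm b)) hc₀.le
    _ = Real.sqrt 2 * C * (c₀ * ∑ b, ∑ b', Kf b b' * (f b * f b')) := by rw [← Finset.mul_sum]; ring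
    _ ≤ Real.sqrt 2 * C * (c₀ * ((((F.P K).d : ℝ) * (2 * 3) ^ (F.P K).d) * ∑ b, f b ^ 2)) :=
        mul_le_mul_of_nonneg_left (mul_le_mul_of_nonneg_left hschur hc₀.le) (by positivity)
    _ = 32 * Real.sqrt 2 * ε₀ * (1 + ρ) ^ 2 * (((F.P K).d : ℝ) * (2 * 3) ^ (F.P K).d) * ‖toL2 F K c₀ X‖ ^ 2 := by rw [hnormX, hC]; ring

/-- ★★ **THE `hloc` LETTER OF A1 ✓`Prop7OneFormGarding.katoEnergy_le`, DISCHARGED**: at `RegPr F n K ε₀ U₀` (`0 ≤ ε₀`), for every bond field `X`,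
`|re⟪toL2 X, toL2(η⁻²(Δ′₁ − 𝒦)X)⟫| ≤ 32√2·ε₀·(d·6^d)·‖toL2 X‖²` (`abs_re_inner_local_conj_le` at `w ≡ 1`): `C_loc = 32√2·d·6^d·ε₀`, K-FREE, `O(ε₀)`.
[cite: Balaban1985Variational, (134)–(136) p.298, p.299; Balaban1985BackgroundPropagators, (3.10) p.392] -/
theorem abs_re_inner_local_le {ε₀ : ℝ} (hε₀ : 0 ≤ ε₀) (hreg : RegPr F n K ε₀ U₀) (X : PBond (F.P K) 0 → Matrix (Fin 2) (Fin 2) ℂ) :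
    |RCLike.re ⟪toL2 F K c₀ X, toL2 F K c₀ (fun b : PBond (F.P K) 0 => (eta F n K)⁻¹ • (eta F n K)⁻¹ •
        (deltaPrimeOp (torusT (F.P K) 0) (fun μ x => bgUnits F K U₀ ⟨x, μ⟩) 1 (formComp X) b.dir b.src
          - curvOp (torusT (F.P K) 0) (fun μ x => bgUnits F K U₀ ⟨x, μ⟩) (formComp X) b.dir b.src))⟫_ℂ|
      ≤ 32 * Real.sqrt 2 * ε₀ * (((F.P K).d : ℝ) * (2 * 3) ^ (F.P K).d) * ‖toL2 F K c₀ X‖ ^ 2 := by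
  have h := abs_re_inner_local_conj_le F c₀ U₀ hε₀ hreg (fun _ => (1 : ℝ)) (fun _ => zero_lt_one) (ρ := 0)
    (fun b => ⟨by simp, by simp⟩) X
  have e1 : (fun b : PBond (F.P K) 0 => (1 : ℝ) • X b) = X := funext fun b => one_smul _ _
  have e2 : (fun b' : PBond (F.P K) 0 => ((1 : ℝ))⁻¹ • X b') = X := funext fun b => by rw [inv_one, one_smul]
  rw [e1, e2] at h
  simpa using h

/-- ★★★ **THE `hlocw` LETTER OF A2c ✓∕⧗`Prop7OneFormAgmonConj.hVconj_of_letters`, DISCHARGED**: at `RegPr F n K ε₀ U₀` (`0 ≤ ε₀`), for a positive weight with both bond ratios `≤ ρ`,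
with `C_locw := 32√2·ε₀·(d·6^d)·(1 + (1+ρ)²)`, for every `X`:
`re⟪toL2 X, toL2(η⁻²(Δ′₁−𝒦)X)⟫ − C_locw·‖toL2 X‖² ≤ re⟪toL2(w(b₋)·X), toL2(η⁻²(Δ′₁−𝒦)(w(b₋)⁻¹·X))⟫` — the text of `hlocw` VERBATIM. [cite: Balaban1985Variational, (134)–(136) p.298; Balaban1985BackgroundPropagators, Thm 3.1 (3.46) p.398] -/
theorem hlocw_of_regPr {ε₀ : ℝ} (hε₀ : 0 ≤ ε₀) (hreg : RegPr F n K ε₀ U₀)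
    (w : Site (F.P K) 0 → ℝ) (hw : ∀ x, 0 < w x) {ρ : ℝ}
    (hρ : ∀ b : PBond (F.P K) 0, |w b.tgt / w b.src - 1| ≤ ρ ∧ |w b.src / w b.tgt - 1| ≤ ρ) :
    ∀ X : PBond (F.P K) 0 → Matrix (Fin 2) (Fin 2) ℂ,
      RCLike.re ⟪toL2 F K c₀ X, toL2 F K c₀ (fun b : PBond (F.P K) 0 => (eta F n K)⁻¹ • (eta F n K)⁻¹ •
            (deltaPrimeOp (torusT (F.P K) 0) (fun μ x => bgUnits F K U₀ ⟨x, μ⟩) 1 (formComp X) b.dir b.src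
              - curvOp (torusT (F.P K) 0) (fun μ x => bgUnits F K U₀ ⟨x, μ⟩) (formComp X) b.dir b.src))⟫_ℂ
          - (32 * Real.sqrt 2 * ε₀ * (((F.P K).d : ℝ) * (2 * 3) ^ (F.P K).d) * (1 + (1 + ρ) ^ 2)) * ‖toL2 F K c₀ X‖ ^ 2
        ≤ RCLike.re ⟪toL2 F K c₀ (fun b => w b.src • X b), toL2 F K c₀ (fun b : PBond (F.P K) 0 => (eta F n K)⁻¹ • (eta F n K)⁻¹ •
            (deltaPrimeOp (torusT (F.P K) 0) (fun μ x => bgUnits F K U₀ ⟨x, μ⟩) 1 (formComp (fun b' : PBond (F.P K) 0 => (w b'.src)⁻¹ • X b')) b.dir b.src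
              - curvOp (torusT (F.P K) 0) (fun μ x => bgUnits F K U₀ ⟨x, μ⟩) (formComp (fun b' : PBond (F.P K) 0 => (w b'.src)⁻¹ • X b')) b.dir b.src))⟫_ℂ := by
  intro X
  have h1 := abs_le.mp (abs_re_inner_local_le F c₀ U₀ hε₀ hreg X)
  have h2 := abs_le.mp (abs_re_inner_local_conj_le F c₀ U₀ hε₀ hreg w hw hρ X)
  have hX0 : 0 ≤ ‖toL2 F K c₀ X‖ ^ 2 := sq_nonneg _
  nlinarith [h1.2, h2.1, hX0]

end L2

end Summit.QuantumFields.YangMills.Theorems.Prop7OneFormAgmonLocal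

end
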